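import Summits.QuantumFields.YangMills.Theorems.UnitScaleTiltProp8FlatProp4Bg1Local
import HarnessLib

/-!
# Route `UnitScaleTilt`, crux K1 child «MinimiserStabilityRegPr» (stmt-QuantumFields-19200), registered stub V2′ `stub_halvingStep` (v8 5b4e846794b80374 ∕ v10
# `BirthV10`) — pillar P3b, **THE LEVEL-WEIGHTED FORM OF [Balaban1985Variational] PROPOSITION 4 (98) AT BACKGROUND 1 FOR THE PURE ACTION**:
# `w₁(b)³‖W₀(A)(b)‖ ≤ 4dΛ³(1428 + Λ)·r²` at EVERY bond, for every field with the weighted (115)/(152)-sizes `w₁(b)‖A(b)‖ ≤ r`, `w₁(b)²η⁻¹‖A(b + e_ν) − A(b)‖ ≤ r`,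
# `r < 1/(2Λ)`, and any weights `η ≤ w₁ ≤ 1` comparable within sup-distance `2` (`w₁(b) ≤ Λw₁(b′)`; print's `w₁ = L^{j(b₋)}η`, `Λ = L²`) — the `hWq` shape of the
# cube-sequence socket `FlatSmallSolution158CubeSeq.existsUnique_smallSolution158_dom` (`w m = w₁^m`), from the LOCAL two-parameter bound `FlatProp4Bg1.norm_gradient_le_local`

Cell `ym3-torus` (HUMAN RULING D-0037, YM ladder rung R3 — continuum SU(2) YM₃ on the torus is a RUNG, not the Clay problem), width seat `ym-ust-19200-w5` gen 2
(P3b lineage).  `--supports stmt-QuantumFields-19200 --as helper`; def-free, 0 sorry, standard axioms.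

THE PRINT (T. Bałaban, CMP **102** (1985) 277–309; journal page = PDF page + 276).  p. 293 (98): *«|(δ/δA′)V(A′)|₍₋₃₎ ≤ C₄(max{|A′|₍₋₁₎, |∇A′|₍₋₂₎})², and it is
valid if max{|A′|₍₋₁₎, |∇^ηA′|₍₋₂₎} ≤ a₃»*; p. 286: *«sup_j L^jη sup_{Ω_j}|A′| = |A′|₍₋₁₎»*; (115) p. 294; (152) p. 301.

WHAT THIS FILE PROVES: **`weighted98_of_local`** (module headline; the case `r ≤ 0` by the limit `t ↓ 0` of the positive-radius bound).  At `w₁(b) = L^{j(b₋)}η` (`IsLevWeight`):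
`w₁³ = w 3`, `w₁² · η⁻¹ = w 2 · L^{K−n}` — the letters of `existsUnique_smallSolution158_dom` with `a₃ = 1/(2Λ)`, `C₄ = 4dΛ³(1428 + Λ)`.
HONEST SCOPE: the comparability of the cube sequence's level weights within distance `2` (neighbouring blocks' levels differ by ≤ 1 under the separation
[Balaban1984PropagatorsII] (2.1)–(2.2)) is a hypothesis here; pure action only (dressing: `FlatProp4Dressing`); NOT a claim about the stub, the crux, the rung or the gap.

References: T. Bałaban, CMP **102** (1985) 277–309 [Balaban1985Variational] p.286, (97)–(98) pp.292–293, (115) p.294, (152) p.301; CMP **96** (1984) 223–250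
[Balaban1984PropagatorsII] (2.1)–(2.2) p.224.
-/

set_option autoImplicit false

noncomputable section

open scoped BigOperators Matrix.Norms.L2Operator
open NormedSpace Finset

namespace Summit.QuantumFields.YangMills.Theorems.FlatProp4Bg1

open Literature.MathematicalPhysics.QuantumFieldTheory.Balaban1983to89
open B5Eq117TorusCarriers (Mk)
open B5Prop12FieldsLattice (distSite)

variable {P : Params} {j : ℕ}

section Weighted

variable {η : ℝ} [DecidableEq (PBond P j)]

/-! ## §4 The level-weighted (98) from the local bound -/

/-- **THE LEVEL-WEIGHTED (98) FOR THE PURE-ACTION GRADIENT** — the `hWq` shape of `FlatSmallSolution158Levels.existsUnique_smallSolution158W` ∕ `…CubeSeq.existsUnique_smallSolution158_dom`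
with `w m = w₁^m`: for weights `η ≤ w₁(b) ≤ 1` comparable within sup-distance `2` (`w₁(b) ≤ Λ·w₁(b′)` whenever `dist(b′₋, b₋) ≤ 2`; print's `w₁ = L^{j(b₋)}η` on an admissible
domain sequence, `Λ = L²`), every field `A` with `w₁(b)‖A(b)‖ ≤ r` and `w₁(b)²·η⁻¹‖A(b + e_ν) − A(b)‖ ≤ r` at every bond, `r < 1/(2Λ)`, has `w₁(b)³‖W(A)(b)‖ ≤ 4dΛ³(1428 + Λ)·r²` at
every bond, for ANY `W` representing `D𝒱_η` ((grad) of `exists_gradient_prop4_bg1`).  Print: *«|(δ/δA′)V(A′)|₍₋₃₎ ≤ C₄(max{|A′|₍₋₁₎, |∇A′|₍₋₂₎})²»* with the level-weighted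
norms of p. 286. [cite: Balaban1985Variational, (97)-(98) pp.292-293, p.286, (115) p.294, (152) p.301] -/
theorem weighted98_of_local (hη : 0 < η) (W : (PBond P j → Matrix (Fin 2) (Fin 2) ℂ) → (PBond P j → Matrix (Fin 2) (Fin 2) ℂ))
    (hgrad : ∀ A δ : PBond P j → Matrix (Fin 2) (Fin 2) ℂ, fderiv ℂ (fun A : PBond P j → Matrix (Fin 2) (Fin 2) ℂ => (∑ p : Plaq P j, (1 - (2 : ℂ)⁻¹ * Matrix.trace (exp ((Complex.I * (η : ℂ)) • A ⟨p.src, p.μ⟩) * exp ((Complex.I * (η : ℂ)) • A ⟨p.src.shift p.μ, p.ν⟩) * exp (-((Complex.I * (η : ℂ)) • A ⟨p.src.shift p.ν, p.μ⟩)) * exp (-((Complex.I * (η : ℂ)) • A ⟨p.src, p.ν⟩))) + (2 : ℂ)⁻¹ * Matrix.trace (((Complex.I * (η : ℂ)) • A ⟨p.src, p.μ⟩) + ((Complex.I * (η : ℂ)) • A ⟨p.src.shift p.μ, p.ν⟩) + (-((Complex.I * (η : ℂ)) • A ⟨p.src.shift p.ν, p.μ⟩)) + (-((Complex.I * (η :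 ℂ)) • A ⟨p.src, p.ν⟩))) + (4 : ℂ)⁻¹ * Matrix.trace ((((Complex.I * (η : ℂ)) • A ⟨p.src, p.μ⟩) + ((Complex.I * (η : ℂ)) • A ⟨p.src.shift p.μ, p.ν⟩) + (-((Complex.I * (η : ℂ)) • A ⟨p.src.shift p.ν, p.μ⟩)) + (-((Complex.I * (η : ℂ)) • A ⟨p.src, p.ν⟩))) ^ 2)))) A δ = (η : ℂ) ^ 4 * ∑ b : PBond P j, Matrix.trace (W A b * δ b))
    (w₁ : PBond P j → ℝ) {Λ : ℝ} (hΛ : 1 ≤ Λ) (hwη : ∀ b, η ≤ w₁ b) (hw1 : ∀ b, w₁ b ≤ 1)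
    (hcmp : ∀ b b' : PBond P j, distSite (Mk P j) b'.src b.src ≤ 2 → w₁ b ≤ Λ * w₁ b')
    (A : PBond P j → Matrix (Fin 2) (Fin 2) ℂ) {r : ℝ} (hr : r < 1 / (2 * Λ))
    (h1 : ∀ b, w₁ b * ‖A b‖ ≤ r)
    (h2 : ∀ (b' : PBond P j) (ν : Fin P.d), w₁ b' ^ 2 * (η⁻¹ * ‖A ⟨b'.src.shift ν, b'.dir⟩ - A b'‖) ≤ r) (b : PBond P j) :
    w₁ b ^ 3 * ‖W A b‖ ≤ 4 * P.d * (Λ ^ 3 * (1428 + Λ)) * r ^ 2 := by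
  have hwpos : ∀ b', 0 < w₁ b' := fun b' => hη.trans_le (hwη b')
  have hΛ0 : 0 < Λ := by linarith
  have hd0 : (0 : ℝ) ≤ P.d := Nat.cast_nonneg _
  -- the positive-radius case, for every admissible `t`
  have key : ∀ t : ℝ, 0 < t → t < 1 / (2 * Λ) → (∀ b', w₁ b' * ‖A b'‖ ≤ t) →
      (∀ (b' : PBond P j) (ν : Fin P.d), w₁ b' ^ 2 * (η⁻¹ * ‖A ⟨b'.src.shift ν, b'.dir⟩ - A b'‖) ≤ t) →
      w₁ b ^ 3 * ‖W A b‖ ≤ 4 * P.d * (Λ ^ 3 * (1428 + Λ)) * t ^ 2 := by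
    intro t ht htΛ h1t h2t
    set w : ℝ := w₁ b with hw
    have hw0 : 0 < w := hwpos b
    have hwη' : η ≤ w := hwη b
    have hw1' : w ≤ 1 := hw1 b
    have hΛt : Λ * t < 1 / 2 := by
      have := (lt_div_iff₀ (by positivity : (0 : ℝ) < 2 * Λ)).1 htΛ
      linarith
    have ht1 : t ≤ 1 := by nlinarith
    set s : ℝ := Λ * t / w with hsdef
    set g : ℝ := Λ ^ 2 * t / w ^ 2 with hgdef
    have hs : 0 < s := by positivity
    have hg : 0 ≤ g := by positivity
    have hηs : η * s ≤ 1 / 2 := by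
      have e : η * s = (η / w) * (Λ * t) := by rw [hsdef]; ring
      have h' : η / w ≤ 1 := (div_le_one hw0).2 hwη'
      rw [e]
      nlinarith [div_nonneg hη.le hw0.le]
    -- the local sizes
    have hA : ∀ b' : PBond P j, distSite (Mk P j) b'.src b.src ≤ 2 → ‖A b'‖ ≤ s := by
      intro b' hd
      have hc : w ≤ Λ * w₁ b' := hcmp b b' hd
      have ha : ‖A b'‖ ≤ t / w₁ b' := by
        rw [le_div_iff₀ (hwpos b')]; have := h1t b'; linarith [mul_comm (w₁ b') ‖A b'‖]
      refine ha.trans ?_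
      rw [hsdef, div_le_div_iff₀ (hwpos b') hw0]
      nlinarith
    have hD : ∀ (s' : Site P j) (μ ν : Fin P.d), distSite (Mk P j) s' b.src ≤ 2 → η⁻¹ * ‖A ⟨s'.shift ν, μ⟩ - A ⟨s', μ⟩‖ ≤ g := by
      intro s' μ ν hd
      have hc : w ≤ Λ * w₁ ⟨s', μ⟩ := hcmp b ⟨s', μ⟩ hd
      have hX0 : 0 ≤ η⁻¹ * ‖A ⟨s'.shift ν, μ⟩ - A ⟨s', μ⟩‖ := by positivity
      have ha : η⁻¹ * ‖A ⟨s'.shift ν, μ⟩ - A ⟨s', μ⟩‖ ≤ t / w₁ ⟨s', μ⟩ ^ 2 := by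
        rw [le_div_iff₀ (pow_pos (hwpos _) 2)]; have := h2t ⟨s', μ⟩ ν; linarith [mul_comm (w₁ ⟨s', μ⟩ ^ 2) (η⁻¹ * ‖A ⟨s'.shift ν, μ⟩ - A ⟨s', μ⟩‖)]
      refine ha.trans ?_
      rw [hgdef, div_le_div_iff₀ (pow_pos (hwpos _) 2) (pow_pos hw0 2)]
      have hc2 : w ^ 2 ≤ (Λ * w₁ ⟨s', μ⟩) ^ 2 := pow_le_pow_left₀ hw0.le hc 2
      nlinarith
    have hW := norm_gradient_le_local hη W hgrad hs hg hηs A b hA hD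
    -- weights
    have e1 : w ^ 3 * (20 * s * g) = 20 * Λ ^ 3 * t ^ 2 := by rw [hsdef, hgdef]; field_simp
    have e2 : w ^ 3 * (η * g ^ 2) = (η / w) * (Λ ^ 4 * t ^ 2) := by rw [hgdef]; field_simp
    have e3 : w ^ 3 * (1408 * s ^ 3) = 1408 * Λ ^ 3 * t ^ 3 := by rw [hsdef]; field_simp
    have b2 : (η / w) * (Λ ^ 4 * t ^ 2) ≤ Λ ^ 4 * t ^ 2 := by
      have h' : η / w ≤ 1 := (div_le_one hw0).2 hwη'
      have : 0 ≤ Λ ^ 4 * t ^ 2 := by positivity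
      nlinarith
    have b3 : 1408 * Λ ^ 3 * t ^ 3 ≤ 1408 * Λ ^ 3 * t ^ 2 := by
      have : t ^ 3 ≤ t ^ 2 := by nlinarith [sq_nonneg t]
      nlinarith [pow_nonneg hΛ0.le 3]
    have hw3 : 0 ≤ w ^ 3 := by positivity
    calc w ^ 3 * ‖W A b‖ ≤ w ^ 3 * (4 * P.d * (20 * s * g + η * g ^ 2 + 1408 * s ^ 3)) := mul_le_mul_of_nonneg_left hW hw3
      _ = 4 * P.d * (w ^ 3 * (20 * s * g) + w ^ 3 * (η * g ^ 2) + w ^ 3 * (1408 * s ^ 3)) := by ring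
      _ = 4 * P.d * (20 * Λ ^ 3 * t ^ 2 + (η / w) * (Λ ^ 4 * t ^ 2) + 1408 * Λ ^ 3 * t ^ 3) := by rw [e1, e2, e3]
      _ ≤ 4 * P.d * (20 * Λ ^ 3 * t ^ 2 + Λ ^ 4 * t ^ 2 + 1408 * Λ ^ 3 * t ^ 2) := by nlinarith
      _ = 4 * P.d * (Λ ^ 3 * (1428 + Λ)) * t ^ 2 := by ring
  rcases lt_or_ge 0 r with hr0 | hr0
  · exact key r hr0 hr h1 h2
  · -- `r ≤ 0`: the sizes vanish, so the bound holds at every small positive radius, hence at `0 ≤ C·r²`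
    have hC : 0 ≤ 4 * P.d * (Λ ^ 3 * (1428 + Λ)) := by positivity
    have hsmall : ∀ t : ℝ, 0 < t → t < 1 / (2 * Λ) → w₁ b ^ 3 * ‖W A b‖ ≤ 4 * P.d * (Λ ^ 3 * (1428 + Λ)) * t ^ 2 := fun t ht htΛ =>
      key t ht htΛ (fun b' => (h1 b').trans (hr0.trans ht.le)) (fun b' ν => (h2 b' ν).trans (hr0.trans ht.le))
    have hle : w₁ b ^ 3 * ‖W A b‖ ≤ 0 := by
      refine le_of_forall_pos_le_add fun ε hε => ?_
      set C : ℝ := 4 * P.d * (Λ ^ 3 * (1428 + Λ)) with hCdef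
      have hq : (0 : ℝ) < 1 / (2 * Λ) := by positivity
      set t : ℝ := min (1 / (4 * Λ)) (ε / (C + 1)) with htdef
      have hCp : 0 < C + 1 := by linarith
      have htpos : 0 < t := lt_min (by positivity) (div_pos hε hCp)
      have htΛ : t < 1 / (2 * Λ) := lt_of_le_of_lt (min_le_left _ _) (by
        rw [div_lt_div_iff₀ (by positivity) (by positivity)]; nlinarith)
      have htε : t ≤ ε / (C + 1) := min_le_right _ _
      have ht1 : t ≤ 1 := by
        have : (1 : ℝ) / (4 * Λ) ≤ 1 := by rw [div_le_one (by positivity)]; linarith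
        exact (min_le_left _ _).trans this
      have h1' := hsmall t htpos htΛ
      have h2' : C * t ^ 2 ≤ C * t := by
        have : t ^ 2 ≤ t := by nlinarith
        exact mul_le_mul_of_nonneg_left this hC
      have h3' : C * t ≤ (C + 1) * t := by nlinarith
      have h4' : (C + 1) * t ≤ (C + 1) * (ε / (C + 1)) := mul_le_mul_of_nonneg_left htε hCp.le
      have h5' : (C + 1) * (ε / (C + 1)) = ε := by field_simp
      linarith
    exact hle.trans (by positivity)


end Weighted

/-! ## §5 At the d = 3 carrier with the level weights of a domain sequence: the `hWq` letter of `existsUnique_smallSolution158_dom` -/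

section T3

open T3ContinuumYM3Torus (T3Family)
open B11Eq115Space (levOf levOf_le)

/-- **THE LEVEL-WEIGHTED (98) AT THE d = 3 CARRIER ON A DOMAIN SEQUENCE `Ω`** (weights `w m b = (L^{j(b₋)}η)^m`, `η = L^{−(K−n)}`, F4's `hw` convention): if the first weight is
comparable within sup-distance `2` (`w₁(b) ≤ Λw₁(b′)`, `Λ ≥ 1` — for the cube sequence (144), neighbouring blocks' levels differ by at most one and `Λ = L²`), then for ANY
`W` representing `D𝒱_η`: `w₃(b)‖W(Y)(b)‖ ≤ 12Λ³(1428 + Λ)·r²` whenever `w₁(b)‖Y(b)‖ ≤ r`, `w₂(b)L^{K−n}‖Y(b + e_ν) − Y(b)‖ ≤ r` everywhere and `r < 1/(2Λ)` — VERBATIM the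
`hWq` hypothesis of `FlatSmallSolution158CubeSeq.existsUnique_smallSolution158_dom` ∕ `letter_solution158_dom_le` with `a₃ = 1/(2Λ)`, `C₄ = 12Λ³(1428 + Λ)`; member-uniform.
[cite: Balaban1985Variational, (97)-(98) pp.292-293, p.286, (152) p.301, (158) p.302] -/
theorem weighted98_dom_T3 (F : T3Family) (n K : ℕ) (Ω : ℕ → Set (Site (F.P K) 0)) (w : ℕ → PBond (F.P K) 0 → ℝ)
    (hw : ∀ m b, w m b = ((F.L : ℝ) ^ levOf Ω (K - n) b.src * ((F.L : ℝ)⁻¹) ^ (K - n)) ^ m)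
    {Λ : ℝ} (hΛ : 1 ≤ Λ) (hcmp : ∀ b b' : PBond (F.P K) 0, distSite (Mk (F.P K) 0) b'.src b.src ≤ 2 → w 1 b ≤ Λ * w 1 b')
    (W : (PBond (F.P K) 0 → Matrix (Fin 2) (Fin 2) ℂ) → (PBond (F.P K) 0 → Matrix (Fin 2) (Fin 2) ℂ))
    (hgrad : ∀ A δ : PBond (F.P K) 0 → Matrix (Fin 2) (Fin 2) ℂ, fderiv ℂ (fun A : PBond (F.P K) 0 → Matrix (Fin 2) (Fin 2) ℂ => (∑ p : Plaq (F.P K) 0, (1 - (2 : ℂ)⁻¹ * Matrix.trace (exp ((Complex.I * (((((F.L : ℝ)⁻¹) ^ (K - n) : ℝ)) : ℂ)) • A ⟨p.src, p.μ⟩) * exp ((Complex.I * (((((F.L : ℝ)⁻¹) ^ (K - n) : ℝ)) : ℂ)) • A ⟨p.src.shift p.μ, p.ν⟩) * exp (-((Complex.I * (((((F.L : ℝ)⁻¹) ^ (K - n) : ℝ)) : ℂ)) • A ⟨p.src.shift p.ν, p.μ⟩)) * exp (-((Complex.I * (((((F.L : ℝ)⁻¹) ^ (K - n) : ℝ)) :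 ℂ)) • A ⟨p.src, p.ν⟩))) + (2 : ℂ)⁻¹ * Matrix.trace (((Complex.I * (((((F.L : ℝ)⁻¹) ^ (K - n) : ℝ)) : ℂ)) • A ⟨p.src, p.μ⟩) + ((Complex.I * (((((F.L : ℝ)⁻¹) ^ (K - n) : ℝ)) : ℂ)) • A ⟨p.src.shift p.μ, p.ν⟩) + (-((Complex.I * (((((F.L : ℝ)⁻¹) ^ (K - n) : ℝ)) : ℂ)) • A ⟨p.src.shift p.ν, p.μ⟩)) + (-((Complex.I * (((((F.L : ℝ)⁻¹) ^ (K - n) : ℝ)) : ℂ)) • A ⟨p.src, p.ν⟩))) + (4 : ℂ)⁻¹ * Matrix.trace ((((Complex.I * (((((F.L : ℝ)⁻¹) ^ (K - n) : ℝ)) : ℂ)) • A ⟨p.src, p.μ⟩) + ((Complex.I * (((((F.L : ℝ)⁻¹) ^ (K - n) : ℝ)) : ℂ)) • A ⟨p.src.shift p.μ, p.ν⟩) + (-((Complex.I * (((((F.L : ℝ)⁻¹) ^ (K - n) : ℝ)) : ℂ)) • A ⟨p.src.shift p.ν, p.μ⟩)) + (-((Complex.I * (((((F.L : ℝ)⁻¹)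 ^ (K - n) : ℝ)) : ℂ)) • A ⟨p.src, p.ν⟩))) ^ 2)))) A δ =
      ((((F.L : ℝ)⁻¹) ^ (K - n) : ℝ) : ℂ) ^ 4 * ∑ b : PBond (F.P K) 0, Matrix.trace (W A b * δ b)) :
    ∀ (Y : PBond (F.P K) 0 → Matrix (Fin 2) (Fin 2) ℂ) (r : ℝ), r < 1 / (2 * Λ) → (∀ b, w 1 b * ‖Y b‖ ≤ r) →
      (∀ (b : PBond (F.P K) 0) (ν : Fin 3), w 2 b * (F.L : ℝ) ^ (K - n) * ‖Y ⟨b.src.shift ν, b.dir⟩ - Y b‖ ≤ r) →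
        ∀ b, w 3 b * ‖W Y b‖ ≤ 12 * (Λ ^ 3 * (1428 + Λ)) * r ^ 2 := by
  classical
  intro Y r hr h1 h2 b
  have hL : (1 : ℝ) < F.L := by exact_mod_cast F.hL.2
  have hL1 : (1 : ℝ) ≤ F.L := hL.le
  have hη : 0 < (((F.L : ℝ)⁻¹) ^ (K - n)) := pow_pos (inv_pos.mpr (by linarith)) _
  have hinv : ((((F.L : ℝ)⁻¹) ^ (K - n)))⁻¹ = (F.L : ℝ) ^ (K - n) := by rw [inv_pow, inv_inv]
  -- the first weight lies in `[η, 1]`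
  have hwη : ∀ b', (((F.L : ℝ)⁻¹) ^ (K - n)) ≤ w 1 b' := fun b' => by
    rw [hw 1 b', pow_one]
    have h1' : (1 : ℝ) ≤ (F.L : ℝ) ^ levOf Ω (K - n) b'.src := one_le_pow₀ hL1
    nlinarith
  have hw1 : ∀ b', w 1 b' ≤ 1 := fun b' => by
    rw [hw 1 b', pow_one, inv_pow]
    have hk : (F.L : ℝ) ^ levOf Ω (K - n) b'.src ≤ (F.L : ℝ) ^ (K - n) := pow_le_pow_right₀ hL1 (levOf_le Ω (K - n) b'.src)
    have hpos : (0 : ℝ) < (F.L : ℝ) ^ (K - n) := by positivity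
    rw [← div_eq_mul_inv, div_le_one hpos]
    exact hk
  have hpow : ∀ m b', w m b' = w 1 b' ^ m := fun m b' => by rw [hw m b', hw 1 b', pow_one]
  -- the gradient letter in the form of `weighted98_of_local`
  have h2' : ∀ (b' : PBond (F.P K) 0) (ν : Fin (F.P K).d),
      w 1 b' ^ 2 * (((((F.L : ℝ)⁻¹) ^ (K - n)))⁻¹ * ‖Y ⟨b'.src.shift ν, b'.dir⟩ - Y b'‖) ≤ r := by
    intro b' ν
    rw [hinv, ← hpow 2 b', ← mul_assoc]
    exact h2 b' ν
  have h := weighted98_of_local (P := F.P K) (j := 0) hη W hgrad (w 1) hΛ hwη hw1 hcmp Y hr h1 h2' b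
  have hd : ((F.P K).d : ℝ) = 3 := by simp
  rw [hd, ← hpow 3 b] at h
  linarith

end T3

end Summit.QuantumFields.YangMills.Theorems.FlatProp4Bg1

end
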